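import Summits.SmoothPoincare4.SmoothPoincare4.Theses.SymplecticOrigami
import Summits.SmoothPoincare4.SmoothPoincare4.Theorems.NoGenusTwoDoor.Negative.NoncompactDoor

/-!
# Disproof of `NoGenusTwoDoor` — findings (cdisprove, crux stmt-SmoothPoincare4-7842)

Standing adversary's work file for crux `SymplecticOrigami.NoGenusTwoDoor`
(route `route-SmoothPoincare4-SymplecticOrigami`, rank 2), generation 1 (opening seat,
refuter-cdisprove-stmt-SmoothPoincare4-7842-0, 2026-08-16; v2.5) EXTENDED by generation 2
(refuter-cdisprove-stmt-SmoothPoincare4-7842-g2-0, 2026-08-16; v3, cycle 2: §3 additions, §7–§10) and by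
generation 3 (refuter-cdisprove-stmt-SmoothPoincare4-7842-g3-0, 2026-08-16; v4, cycle 3: §11 Targets audit of
the three registered skeletons, §12 factorization kill criterion, §7 `gompf_bPlusOne_form`, §10 erratum):

> no closed connected symplectic 4-manifold `(N, s)` — `s` a smooth closed pointwise
> non-degenerate `MForm (𝓡 4) N ℝ 2` on a compact boundaryless `ℝ⁴`-charted `C^∞` manifold — has
> `rank H₁(N; ℤ) = 2` and `rank H₂(N; ℤ) = 1` (a "door": `(b₁, b₂) = (2, 1)`).

VERDICT OF CYCLE 3 (gen 3): **no kill; no junk kill; no stub kill.** The crux decl is unchanged. The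
three skeletons registered since cycle 2 (`Lines/canonical-cap-filling.lean`,
`Lines/weinstein_door_presentation.lean`, `Lines/liouville_genus_two_complement.lean`; 13 stubs) were
audited as TARGETS (§11): every stub is either door-vacuous (true if the crux is), crux-equivalent
(S4/W4/L4), or a theorem in print with honest typing (S2, S3, W1; W2/L3 pure topology) — the typed
vocabulary (`BoundaryData`, `IsClosedGluing`, `SteinStructure`, `IsLiouvilleDomain`, `IsBoothbyWang`,
the link model `x² + y⁵ + z¹⁰`) admits no junk instance that falsifies a stub; two pieces of prover
information are formal (`closingUp_without_meridian`: S5 needs no meridian injectivity;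
`cappingAdjunction_square`: W3's `n = a²` is topology, only the genus clause needs Liu). New
reformulation `gompf_bPlusOne_form` (§7): the crux is EXACTLY the `b⁺ = 1` case of Gompf's `χ ≥ 0`
conjecture. New COMPUTABLE KILL CRITERION (§12): a positive factorization of `t_{δ₁}⋯t_{δ₄}` in
`Mod(Σ₄⁴)` into 15 Dehn twists whose vanishing cycles span a 6-dimensional subspace of `H₁(Σ₄; ℚ)`
is a door (degree-2 pencil), `(7, 9, 32, 12)` at degree 3 — unsearched (no structured seed). §10
erratum: the Milnor fibre of `x² + y⁵ + z¹⁰` is `(b₁; χ, b⁻) = (0; 37, 28)`, `b⁺ = b⁰ = 4`.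
Literature this cycle: searchd local index unavailable, OpenAlex/S2 rate-limited (429); zbMATH /
crossref / citation graph live — no new `χ < 0` non-ruled symplectic manifold and no `χ ≥ 0` theorem
at `b⁺ = 1` surfaced among the papers citing Kotschick 2006 (9) and Baldridge–Kirk 2007 (35, to
2026); a FOURTH printed statement of the crux as open belief was READ: Akhmedov–Zhang, *The
fundamental group of symplectic 4-manifolds with b⁺ = 1*, arXiv:1506.08367, §2 p. 6 — "For symplectic
4-manifolds with κˢ = 2 [and b⁺ = 1] there are possibly two cases: b₁ = 2, b⁻ = 0 or b₁ = 0,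
b⁻ = 0, …, 8. The first case is not expected to occur in the symplectic category since there are
currently no examples beyond the BMY line, i.e. c₁² > 3c₂" (the door has `c₁² = 1 > 3c₂ = −3`; their
remark "minimal symplectic with `0 < c₁² ≤ 3c₂` has `b⁺ ≥ b₁ + 1`" and Question 2.11
`b⁺(G) ≤ b₁(G) + 1` frame it; their ref. [Ak] = Akhmedov's infinite family of MINIMAL `κˢ = 1`,
`b⁺ = 1`, `(b₁, b₂) = (2, 2)` manifolds is one more inhabitant list consistent with §7's
`(2, 2)`-form). In progress (gen 3): the COMPACT witness for
`false_withoutNondegenerate` — `ℝP² × T²` realised as the quotient of the open set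
`(ℝ³ ∖ 0) × ℝ ⊂ ℝ⁴` by `⟨−1, ×2⟩ × ℤ` (tree `QuotientManifold`, `RealProjectiveSpace`, circle
Künneth, `𝔽₂`-Euler characteristic) — to replace the `proof_wanted` by an imported Negative lemma.

VERDICT OF CYCLE 2 (gen 2): **still no kill and no junk kill** — the crux decl is unchanged in
route rev 2; a crossref/galaxy sweep (searchd itself still rc 75) — Yazinski JSG 2013 READ (χ =
10 + 4(g + r), σ = −2 for any presented π₁, i.e. 18 for `F₂`), Baldridge Math. Ann. 2005 READ in
full, and at title/abstract level the torus-surgery / fibre-sum geography papers Baldridge–Kirk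
2006/2007/2009 (READ in gen 1), Torres 2011/2013, J. Park 2007, all of which build at `χ ≥ 0` from
`χ ≥ 0` hosts — again finds NO closed symplectic 4-manifold with `b₁ = 2, b₂ = 1` and no exclusion;
a THIRD printed statement of the crux as open belief was located: Stipsicz, Topology Appl. 117
(2002) Remark 3.4, p. 15 (READ): "The existence of a symplectic 4-manifold with `b₂⁺(X) = 1`,
`b₂⁻(X) = 0` and `b₁(X) = 2` would contradict Conjecture 2.10 — it is the author's belief that such
(symplectic) 4-manifold does not exist, although he is unaware of a proof" (with T.-J. Li 2015
§4.3.1 and Kotschick 2006). New this cycle: (a) two more constructions closed — a door is not a quotient/cover/bundle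
(`not_a_quotient`, χ = −1) and not a CYCLIC BRANCHED COVER of anything (`not_cyclic_branched_cover`:
`K² = 1` is not divisible by the degree), §3; (b) four equivalent forms of the crux for provers
(§7: "χ ≥ 0 for symplectic b₁ = 2", "every symplectic (b₁, b₂) = (2, 2) is minimal",
`q^SYMP(G) ≥ 0` for `b₁(G) = 2`, symplectic Castelnuovo–de Franchis "κ = 2 ∧ b⁺ = 1 ⇒ q = 0");
(c) the pencil family of card albanese-isotropic-pencil passes every Lefschetz-fibration inequality
for all `a ≥ 1`, `a = 1` dead by Matsumoto–Endo (§8); (d) complement bookkeeping (§9); (e) TWO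
IDEA-LEVEL REFUTATIONS IN PRINT (§10): Baldridge's `X_g` (Math. Ann. 333 (2005) Thm 1, READ) are
closed symplectic `b⁺ = 1, b₁ = 2, b₂ = 2` manifolds (κ = 1 for g ≥ 2, κ = 0 for g = 1) with
VANISHING cup product on `H¹` and identically vanishing Li–Liu wall-crossing numbers — this kills the
strengthening C⁺⁺ of card picard-loop-classes ("b⁺ = 1 ∧ b₁ = 2 ⇒ cup product non-torsion") and
supplies the κ ≤ 1 laboratory that card could not find; and EXACT FILLINGS WITH `b₁ = 2` of the
genus-2 Boothby–Wang boundary `(Y_{2,−1}, ξ_BW)` exist (complements of the three multisection-type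
genus-2 square-1 curves `5S + F − 3E₁`, `3S + F − 2E₁ − E₂`, `2S + F − E₁ − E₂ − E₃` in
`(T² × S²) # k\overline{ℂP²}`, `k = 1, 2, 3`, `[ω] = PD[B]` by Dorfmeister–Li's relative cone theorem,
READ; `χ(W) = 3, 4, 5`), correcting the zoo of cards liouville-genus-two-complement /
semidefinite-filling-door (`b₁ ∈ {0, 4}` is wrong; the door is the `(b₁, χ) = (2, 1)` point two
`χ`-steps below `W(5S + F − 3E₁)`, not "the unique b₁ = 2 filling"). `false_withoutCompact`
is now a THEOREM here (this file imports the landed `Negative.NoncompactDoor`, p74187): the only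
`proof_wanted`s left are `false_withoutClosed` / `false_withoutNondegenerate`, whose paper witnesses
need a closed `(b₁, b₂) = (2, 1)` smooth 4-manifold in the tree (`(S¹ × S³) # (S¹ × S³) # ℂP²`, or
the non-orientable `ℝP² × T²` for the zero form) — none is constructible there yet.

VERDICT OF CYCLE 1 (kept): **no kill; no junk kill; the statement is the honest open corner
`(b⁺, χ) = (1, −1)` of symplectic geography**, singled out in print by T.-J. Li, *Kodaira dimension
in low dimensional topology*, arXiv:1511.04831 §4.3.1 (READ, p. 11): "the only known symplectic
4-manifolds with negative Euler number are `g ≥ 2` `S²`-bundles and their blow ups up to `4g − 5`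
points ... If a manifold with `b₁ = 2` and `b⁺ = 1` has negative Euler number ... such a manifold has
`χ = −1` and `σ = 1` and hence `K_ω·K_ω = 1`. Since it has `b⁻ = 0` and hence minimal, such a
manifold has `κˢ = 2`"; his Conj. 4.11 (symplectic BMY `K_ω² ≤ 3χ` for `κˢ = 2`) implies the crux
(`1 ≤ −3` fails), as does Gompf's 1995 question "is `χ ≥ 0` for every closed symplectic 4-manifold
that is not ruled?" (recorded OPEN: Kotschick, PAMS 134 (2006),
arXiv:math/0504578, last paragraph, READ here p. 3; Baldridge–Kirk, CMH 82 (2007) Cor. 12 gives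
exactly `−1 ≤ min χ ≤ 12` over symplectic `π₁ = F₂` manifolds, and JDG 82 (2009) §5.3 READ: "we do
not know of any symplectic 4-manifold with fundamental group free of rank n which satisfies
6/5(1−n) ≤ e(M) < 10" except rank 1). Neither direction is within reach of a cheap attack: every
KNOWN obstruction is saturated with equality or slack at the door (§2), and every STANDARD
construction is shown below to be unable to reach the door's numerical class from known manifolds
(§3–§4). ONE HYPOTHESIS IS FORMALLY LOAD-BEARING: compactness (§5; negative lemma
`Negative.NoncompactDoor.noGenusTwoDoor_false_without_compact`, sorry-free, LANDED: p73639 +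
p74187). Prose is in docstrings; everything outside `proof_wanted` is `sorry`-free.

## Findings (index)

* §0 `IsSymplecticMForm`, `BettiDoor`, `crux_iff` — the crux restated over a bundled predicate
  (pure unfolding). FAITHFULNESS (re-checked symbol by symbol, agreeing with the route review and
  the grounder): `MForm` is a genuine field of continuous alternating 2-forms on `TangentSpace = ℝ⁴`;
  `IsSmoothForm` = chartwise `C^∞` at each point in its own chart; `IsClosedForm` = Mathlib's
  `extDerivWithin` of the chart representative vanishes at each point (chart-independent for smooth
  forms); non-degeneracy is typed pointwise and is real; `singularHomologyZ` is Mathlib's singular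
  homology with `ℤ` coefficients and `Module.finrank ℤ` of a f.g. abelian group is its free rank, so
  the two `finrank` clauses are `b₁ = 2`, `b₂ = 1`. No junk model: `N = ∅` is excluded by
  `ConnectedSpace` (and has `b₁ = 0` anyway); finite/discrete `N` are not `ℝ⁴`-charted (a chart is a
  homeomorphism of an open set onto a non-empty open subset of `ℝ⁴`); exotic chartings are genuine
  smooth structures (`IsManifold … ∞`), on which the statement is equally meaningful.
* §1 ONE SEMANTIC CAVEAT (formal): `IsClosedForm` alone is junk-satisfiable —
  `mextDeriv_eq_zero_of_not_differentiableWithinAt`: at a point where the chart representative is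
  not differentiable, Mathlib's `fderivWithin` is `0`, so `dα = 0` there by fiat; hence a nowhere
  differentiable non-degenerate 2-form field is "closed". The crux is protected because it ALSO
  assumes `IsSmoothForm`; provers must never detach `IsClosedForm s` from `IsSmoothForm s`
  (`isClosedForm_of_forall_not_differentiableWithinAt`).
* §2 NUMERICAL RESISTANCE (integer lemmas, `omega`): `door_numerics` — a door has
  `(b⁺, b⁻, χ, σ, K², χ_h) = (1, 0, −1, 1, 1, 0)`; `liu_table` — for `b⁺ = 1`, `K² = 9 − 4b₁ − b⁻ ≥ 0`
  and `b₁` even leave exactly the cells `b₁ = 0, b⁻ ≤ 9` and `b₁ = 2, b⁻ ≤ 1`, the door being the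
  extremal cell `(2, 0)` with `K² = 1` (Liu 1996: minimal non-ruled `b⁺ = 1 ⇒ K² ≥ 0` is satisfied,
  not violated); `kotschick_boundary` — Kotschick's `χ ≥ −6/5 (b₁ − 1)` reads `χ ≥ −1` at `b₁ = 2`:
  the door sits ON the published lower bound; `cover_tower` — every connected `d`-fold cover of a
  door is symplectic with `(χ, σ, χ_h, K²) = (−d, d, 0, d)`, `b⁺ = b₁ − 1`, `b⁻ = b₁ − 1 − d ≥ 0`,
  hence `b₁ ≥ d + 1`: Taubes' `K² ≥ 0` (b⁺ > 1) is again satisfied with slack, BMY `K² ≤ 9χ_h` and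
  Gompf `χ ≥ 0` are violated but both are CONJECTURES for symplectic `κ = 2`;
  `no_small_b1_cover` — consequently `π₁(door)` has NO finite-index subgroup of index `d ≥ 2` with
  `b₁ ≤ d` (so `π₁ ≠ ℤ²`, not virtually nilpotent/solvable, not `F₂ × (finite ≠ 1)`; with Lück's
  `χ = b₂⁽²⁾ − 2 b₁⁽²⁾(π₁)` one gets `b₁⁽²⁾(π₁) ≥ 1/2`: non-amenable, as Kotschick remarks for any
  `q^DIFF < 0` group). The free group `F₂` fits every constraint with equality (`b₁` of an index-`d`
  subgroup is exactly `d + 1`): the sharpest one-line form of the crux is Kotschick's boundary case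
  **`q^SYMP(F₂) = −1 ?`** (his Thm 1 proves `≥ −1`).
  If `π₁ = F₂` (more generally whenever `b⁻(X_d) = 0`): `H₂(X_d)/tors ≅ ℤ^d` DIAGONAL (Donaldson,
  any `π₁`), `K_d = π*K = π*h = (1,…,1)` (the deck group permutes the basis; `(π*h)² = d`),
  `[ω_d] ∝ K_d`, and every basis vector `eᵢ` has `eᵢ² = K·eᵢ = 1`, Gromov–Taubes dimension `0` and
  positive area — `X_d` looks like `d` doors' worth of genus-2 square-1 classes; the canonical curve
  `B ⊂ X` either lifts to `d` disjoint copies (classes `e₁,…,e_d`) or is covered by one connected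
  genus-`(d+1)` curve in class `K_d`. No contradiction is visible at any level `d`.
  `posDef_no_isotropic`, `adjunction_no_tori` — `b⁻ = 0`: the form on `H₂/torsion = ℤh` is `(1)`,
  so a door has no rationally essential class of square `≤ 0`: no Lefschetz FIBRATION over a curve,
  no square-zero symplectic torus (no fibre sum or knot surgery can be performed on it or end at it),
  every Lagrangian torus is rationally null-homologous, and by adjunction (SW basic class `K = h`,
  chamber-free since `H¹ ∪ H¹` is torsion) the minimal genus of `c·h` is `1 + (c² + |c|)/2 ≥ 2`.
* §3 CONSTRUCTIONS THAT CANNOT REACH THE DOOR (the class `𝒟 = {(χ, σ) = (−1, 1)}`, equivalently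
  `(χ_h, K²) = (0, 1)`, any `b₁`; Luttinger/torus/knot surgery preserve `(χ, σ)` and so move only
  INSIDE `𝒟 ∪` (Gompf counterexamples), never into it from a known manifold):
  - Kähler/complex: none (`b₁` even ⇒ Kähler; `q = 1, p_g = 0 ⇒ χ(𝒪) = 0 ⇒ κ ≤ 1 ⇒ K² = 0,
    e = 0 ⇒ b₂ = 2`): the Enriques–Kodaira table has no `(2, 1)` entry.
  - symplectic sum along a genus-`g ≥ 1` square-zero surface: `χ = χ₁ + χ₂ + 4(g − 1)` with a ruled
    summand over `Σ_h` forced to meet the surface in a `d`-multisection, `g − 1 ≥ d(h − 1)`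
    (Kneser/Riemann–Hurwitz), so `χ ≥ χ(non-ruled summand) ≥ 0` or (two ruled, `d, d' ≥ 2`)
    `χ ≥ 0`; sums along sections are identity operations; `g = 0` sums stay rational/ruled (McDuff).
  - Luttinger surgery preserves `κ` (Ho–Li 2012) and `(χ, σ)`: from ruled stays ruled, from `κ ≥ 0`
    needs a host already in `𝒟`.
  - branched covers: a double branched cover has `χ = 2χ(Y) − χ(B)` EVEN, never `−1`; symplectic
    circle actions are excluded (`χ = −1 ≠ 0` rules out fixed-point-free actions, a fixed point
    makes the action Hamiltonian (McDuff 1988) hence `N` rational/ruled (Audin–Ahara–Hattori,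
    Karshon)); no Lefschetz fibration over a curve (`b⁻ = 0`, §2) — only Donaldson pencils, whose
    blow-ups `N # kℂP²bar → S²` have `(χ_h, c₁²) = (0, 1 − k)` and genus `g` with `μ = 4g − 5 + k`
    singular fibres, violating no known Lefschetz-fibration inequality.
  - RATIONAL BLOWDOWN is the one `χ`-DECREASING operation (`χ ↦ χ − (p − 1)`, `σ ↦ σ + (p − 1)`):
    `blowdown_host_numerics` — a host whose `C_p`-type blowdown lands in `𝒟` has
    `(b⁺, b⁻, K²) = (b₁ − 1, b₁ + p − 3, 2 − p)`, so (Liu/Taubes) it is a `(p − 2 + j)`-fold blow-up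
    of a minimal `Y` with `(χ_h, K²) = (0, j)`: `j ≥ 1` is circular (`Y ∈` Gompf's unknown class),
    `j = 0` means `Y` has `χ = σ = 0`, `κ ∈ {0, 1}` — every KNOWN such `Y` (T²-bundles over T²,
    bielliptic, `S¹ × M³_fibred`, their knot-surgered/Luttinger variants) is ASPHERICAL, or `Y` is an
    `S²`-bundle over `T²`. In `Y # k\overline{ℂP²}` an embedded sphere lifts to the universal cover,
    so its class lies in `⊕ ℚEⱼ` (aspherical `Y`) or in `ℚF ⊕ ⊕ ℚEⱼ` (ruled `Y`, projection to
    `T²` kills the section coordinate), where the intersection form is `−Σ cⱼ²` with `F` ISOTROPIC;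
    a blow-down configuration must span a NEGATIVE DEFINITE sublattice of rank `b⁻(host) = k + 1`
    (`k + b₁ − 1 ≥ k + 1` in general) — impossible: `sphereSpan_not_negDef` (k+1 vectors in
    `ℚF ⊕ ℚᵏ` have a non-zero combination with vanishing `ℚᵏ`-part, on which the form is `0`).
    So NO rational blowdown (of any plumbing of spheres bounding a ℚ-homology ball: Fintushel–Stern
    `C_p`, Park `C_{p,q}`, Stipsicz–Szabó–Wahl graphs) of any blow-up of any known manifold is a
    door. The attack survives only through a NON-aspherical minimal symplectic `Y` with
    `χ = σ = 0`, `b⁺ = b₁ − 1` — itself unknown.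
* §4 REFORMULATION AS A FILLING PROBLEM (`filling_numerics`): SW for the door is chamber-free, so
  (Taubes SW = Gr, adjunction) `K = h` is an embedded connected symplectic GENUS-2 curve `B`,
  `B² = 1`; `ν(B)` is a concave cap and `W = N ∖ ν(B)` a strong filling of the Euler-number-`(−1)`
  circle bundle `Y_{2,−1} → Σ₂` with its `S¹`-invariant transverse contact structure `ξ_can`
  (the convex boundary of the disc bundle `D(Σ₂, −1)`), with `χ(W) = 1`, `b₁(W) = 2`, `σ(W) = 0`,
  ZERO intersection form, `H₂(W; ℚ)` spanned by boundary tori. Conversely ANY strong filling `W` of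
  `(Y_{2,−1}, ξ_can)` with `σ(W) = 0`, `b₁(W) = 2`, `χ(W) = 1` caps off (`W ∪ D(Σ₂, +1)`) to a door —
  an unconditional CONSTRUCTION ROUTE. Known fillings: `D(Σ₂, −1)` (`χ = −2`, caps to the ruled
  surface), complements of `C_p ⊂ Sym²Σ₂` (`χ = 3`) and of blown-up sections of ruled surfaces;
  none has `b₁ = 2`. The cap `D(Σ₂, +1)` has `e = 1 < 2g − 2`: neither uniruled nor Calabi–Yau
  (Li–Mak–Yasui 2017), so no finiteness/classification of fillings is available — the filling
  problem is as open as the crux, but it is where a construction would be attempted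
  (a genus-2 handlebody-like filling killing a Lagrangian half of `H₁(Σ₂)`).
* §5 LOAD-BEARING HYPOTHESES (paper witnesses; formal status):
  - `CompactSpace` — FALSE without it, PROVED and LANDED under `Theorems/NoGenusTwoDoor/Negative/`
    (`OpenSubsetConstForm.lean` = p73639, `NoncompactDoor.lean` = p74187; part 1:
    constant forms on open subsets of `ℝⁿ` are `IsSmoothForm` ∧ `IsClosedForm` — the Opens chart is
    the inclusion and `mfderivWithin (extChartAt).symm = id` on its target) and part 2
    (`noGenusTwoDoor_false_without_compact`, `exists_noncompact_door`): witness
    `U = (ℝ² ∖ 0)² ⊂ ℝ⁴` open with `dx₀∧dx₁ + dx₂∧dx₃` (`ω₀(v, Jv) = |v|²`), `U ≃ₕ S¹ × S¹ ≃ₜ T²`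
    by radial projection, `b₁ = 2`, `b₂ = 1` from the tree's `H_k(T²; ℤ) ≅ ℤ^(2 choose k)`. This also
    certifies NON-VACUITY of the crux's form hypotheses: smooth ∧ closed ∧ non-degenerate `MForm`s
    exist on `(𝓡 4)`-manifolds of the tree (so the crux is not true for lack of forms). Here:
    `WithoutCompact` + THEOREM `false_withoutCompact` (cycle 2: the tree module is now imported and
    `Negative.noGenusTwoDoor_false_without_compact` re-bundled — gen 1 had to leave a `proof_wanted`
    because the farm snapshot lagged the commit).
  - `IsClosedForm` — FALSE without it: `(S¹ × S³) # (S¹ × S³) # ℂP²` has `(b₁, b₂, χ, σ) =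
    (2, 1, −1, 1)`, `χ + σ ≡ 0 (4)` and `c = h` with `c² = 2χ + 3σ = 1`, `c ≡ w₂`, so (Wu /
    Hirzebruch–Hopf) it is almost complex and carries a smooth non-degenerate 2-form; not symplectic
    (SW vanish on the connected sum; or: `b⁺ = 1`, `b₁ = 2`, `π₁ = F₂`... it would BE a door).
    Not formalisable here (no connected sums / almost-complex structures in the tree):
    `proof_wanted false_withoutClosed`.
  - non-degeneracy — FALSE without it: `s = 0` on the same manifold (`proof_wanted`).
  - `IsSmoothForm` — see §1: without it `IsClosedForm` degenerates; witness = the almost-complex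
    form above made nowhere differentiable (paper).
  - `ConnectedSpace` — NOT load-bearing (`∅` has `b₁ = 0`; a disconnected closed symplectic `N`
    has `b₂ ≥ #components ≥ 2`). Information for provers: `[ConnectedSpace N]` may be dropped;
    `T2`/`SecondCountable` are regularity; `CompactSpace`, smooth + closed, non-degenerate are each
    essential.
* §6 WHAT A KILL WOULD BE: a closed symplectic `(N, s)` with `π₁` "free-like" (`b₁ = 2`, every
  index-`d` subgroup with `b₁ ≥ d + 1`, `b₁⁽²⁾ ≥ 1/2`), `H₂/tors = ℤh`, `h² = 1`, `K = h` a genus-2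
  curve — the first symplectic 4-manifold of non-negative Kodaira dimension with `χ < 0`. By the
  route's kill criteria it closes `NoGenusTwoDoor` as `refuted-substantive` (no side condition is
  missing: the statement means what it says) unless two doors glue along `Y_{2,±1}` to a homotopy
  sphere. Search for one in print (2026-08-16): Kotschick 2006 READ (open); route/grounder searches
  (Li 2006 κ=0, Baldridge–Li 2005 κ=1, Usher 2009, Li–Liu 2001: all `κ ≤ 1` examples have `σ = 0`,
  `b₂` even); `lit search`/galaxy degraded this session (searchd rc 75) — to be re-run: Baldridge–Kirk
  2007/2009 (`q^SYMP` tables for `F₂`, `ℤ²`), T.-J. Li's Kodaira-dimension surveys, Dorfmeister–Zhang,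
  Akhmedov–Park small-`χ` constructions with `b₁ > 0`.
  CYCLE 2 re-run (crossref live, searchd still rc 75): Yazinski JSG 11 (2013) READ (Thm 1.1:
  `χ = 10 + 4(g + r)`, `σ = −2` for ANY presentation — 18 for `F₂`, no negative-`χ` reach);
  Baldridge–Kirk JSG 2006 / CMH 2007 / JDG 2009 (READ gen 1), Torres 2011/2013 (abelian π₁),
  J. Park PAMS 2007 — torus-surgery / fibre-sum geography at `χ ≥ 0` (title/abstract level this
  cycle); Baldridge Math. Ann. 2005 READ in full (his `b⁺ = 1, b₁ = 2` manifolds all have `b₂ = 2`,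
  see §10); Stipsicz 2002 READ (Remark 3.4 = the crux as open belief; §8). A door is moreover
  PRIMITIVE (§3 `not_a_quotient`, `not_cyclic_branched_cover`): not a cover, quotient, bundle, or
  cyclic branched cover of anything.
* §7 REFORMULATIONS (integer lemmas): `b1two_form` — NoGenusTwoDoor ⟺ "closed symplectic
  `b₁ = 2 ⇒ χ ≥ 0`" ⟺ "`⇒ b₂ ≥ 2`" ⟺ `q^SYMP(G) ≥ 0 ∀ G, b₁(G) = 2`; `b1two_b2two_form`,
  `blowup_door_numerics` — `door # \overline{ℂP²}` has the numerics of `T² × S²`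
  (`(2, 2, 1, 1, 0, 0, 0)`, odd form), so NoGenusTwoDoor ⟺ "every closed symplectic 4-manifold with
  `b₁ = b₂ = 2` is minimal" (all known ones — `T² × S²`, `S² ×~ T²`, `T²`-bundles, `S¹ × M_K`,
  Baldridge's `X_g` — are, having κ ≤ 1 and `K² = 0`); `castelnuovo_form` — ⟺ "κˢ = 2 ∧ b⁺ = 1 ⇒
  b₁ = 0 (χ_h = 1)", the symplectic Castelnuovo–de Franchis / `χ(𝒪) ≥ 1` statement.
  Cycle 3: `gompf_bPlusOne_form` — ⟺ "`b⁺ = 1 ∧` not rational/ruled `⇒ χ ≥ 0`" (Gompf at `b⁺ = 1`).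
* §8 PENCILS (card albanese-isotropic-pencil): `pencil_numerics` (`g = (a² + a + 2)/2`,
  `n = 3a² + 2a − 1`, `σ = 1 − a²`, `λ = g − 1`, `K²_{X/S²} = 3a² + 4a + 1`, slope `6 + 2/a`),
  `pencil_passes_LF_inequalities` (`5n ≥ 8g − 4`, Ozbagci, `b₁ ≤ g`, slope bounds — all hold for
  every `a ≥ 1`), `pencil_passes_stipsicz` (Stipsicz 2002 Lemma 3.2 / Thm 2.6 with slack
  `(a + 1)²`, `2(a + 1)²`), `pencil_a_one_dead` (Matsumoto–Endo genus-2 signature formula).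
* §9 COMPLEMENT (cards liouville-genus-two-complement / semidefinite-filling-door):
  `complement_bookkeeping` — `W = N ∖ νB`: `b₁ = 2`, `b₂ = 4 − r`, `b₃ = 2 − r`, `χ = 1`,
  `Q_W ≡ 0`, `[ω]|_W = 0` (exact), Weinstein only if `r = 2`.
* §10 IDEA-LEVEL REFUTATIONS IN PRINT (paper; cited; the Lean lemmas carry only the arithmetic):
  `baldridge_lab_form` — Baldridge's `X_g` (κ ≤ 1, `b⁺ = 1`, `b₁ = b₂ = 2`, cup product on `H¹`
  ZERO, all wall-crossing numbers zero) refutes "b⁺ = 1 ∧ b₁ = 2 ⇒ cup non-degenerate" (card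
  picard-loop-classes C⁺⁺) and is the missing laboratory; `ruledT2_genus_two_classes`,
  `ruledT2_filling_numerics` — exact fillings of `(Y_{2,−1}, ξ_BW)` with `b₁ = 2` exist
  (`(χ, b⁻) = (k + 2, k + 1)`, `k = 1, 2, 3`; the family is finite, `genus2_classes.py`), so the door
  is NOT "the unique b₁ = 2 filling type"; it is the `(b₁, χ, b⁻) = (2, 1, 0)` point, the `k = −1`
  extrapolation of that family; `W(2S + F − E₁ − E₂ − E₃)` moreover satisfies Chen 2024's T.1–T.3,
  hence has infinite first capacity. Cross-checked against TRIAGE-r1-1/2/3 (all read at the cycle-2 boundary: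
  their N1 `Nil⁴/Γ`, N2 Milnor fibre, N3 `ℂP² ∖ cubic` calibrations are consistent with and
  complementary to §10; nothing in this file is contradicted by the panel).
* §11 TARGETS (cycle 3): audit of the 13 stubs of the three registered skeletons — door-vacuity map,
  paper checks of the non-vacuous stubs S2/S3/W1, junk audit of the typed vocabulary, link model
  re-verified; formal prover information `closingUp_without_meridian`, `closingUp_arith_general`,
  `cappingAdjunction_square`. No `stub_false`.
* §12 PENCIL FACTORIZATIONS (cycle 3): `pencil_factorization_door`, `pencil_factorization_small_cases`
  — the mapping-class-group form of a kill: `(g, d, n, dim span) = (4, 4, 15, 6)` at degree 2.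
-/

noncomputable section

set_option linter.dupNamespace false

open scoped Manifold ContDiff BigOperators
open Literature.Geometry.Kaehler

namespace Summit.SmoothPoincare4.SmoothPoincare4.Cruxes.NoGenusTwoDoor.Disproof

/-! ## §0 The crux, bundled -/

/-- The three hypotheses the crux places on the 2-form `s`: chartwise smooth, closed, and pointwise
non-degenerate — i.e. `(N, s)` is a symplectic manifold in the tree's `MForm` vocabulary. [folklore] -/
def IsSymplecticMForm {N : Type*} [TopologicalSpace N] [ChartedSpace (EuclideanSpace ℝ (Fin 4)) N]
    (s : MForm (𝓡 4) N ℝ 2) : Prop :=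
  IsSmoothForm s ∧ IsClosedForm s ∧ ∀ x (v : TangentSpace (𝓡 4) x), v ≠ 0 → ∃ w, s x ![v, w] ≠ 0

/-- The conclusion the crux forbids: `(b₁, b₂) = (2, 1)` (free ranks of `H₁(N; ℤ)`, `H₂(N; ℤ)`). [folklore] -/
def BettiDoor (N : Type) [TopologicalSpace N] : Prop :=
  Module.finrank ℤ (Literature.Topology.FourManifolds.singularHomologyZ N 1) = 2 ∧
    Module.finrank ℤ (Literature.Topology.FourManifolds.singularHomologyZ N 2) = 1

/-- The crux is literally "no compact connected `ℝ⁴`-charted `C^∞` 4-manifold carries a symplectic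
`MForm` and has `(b₁, b₂) = (2, 1)`" (pure unfolding). [folklore] -/
theorem crux_iff :
    Summit.SmoothPoincare4.SmoothPoincare4.Theses.SymplecticOrigami.NoGenusTwoDoor ↔
      ∀ (N : Type) [TopologicalSpace N] [T2Space N] [SecondCountableTopology N] [CompactSpace N]
        [ConnectedSpace N] [ChartedSpace (EuclideanSpace ℝ (Fin 4)) N] [IsManifold (𝓡 4) ∞ N]
        (s : MForm (𝓡 4) N ℝ 2), IsSymplecticMForm s → ¬ BettiDoor N := by
  constructor
  · intro h N _ _ _ _ _ _ _ s hs
    exact h N s hs.1 hs.2.1 hs.2.2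
  · intro h N _ _ _ _ _ _ _ s h1 h2 h3
    exact h N s ⟨h1, h2, h3⟩

/-! ## §1 Semantics: closedness is junk without smoothness -/

section Semantics

variable {E : Type*} [NormedAddCommGroup E] [NormedSpace ℝ E] {H : Type*} [TopologicalSpace H]
  {I : ModelWithCorners ℝ E H} {M : Type*} [TopologicalSpace M] [ChartedSpace H M]
  {F : Type*} [NormedAddCommGroup F] [NormedSpace ℝ F] {k : ℕ}

/-- CAVEAT FOR PROVERS. `mextDeriv α x` is Mathlib's `extDerivWithin` of the chart representative,
i.e. the alternatisation of an `fderivWithin`; where the representative is NOT differentiable the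
latter is `0` by definition, so `dα` vanishes there by fiat. [folklore] -/
theorem mextDeriv_eq_zero_of_not_differentiableWithinAt (α : MForm I M F k) (x : M)
    (h : ¬ DifferentiableWithinAt ℝ (α.inChart x) (Set.range I) (extChartAt I x x)) :
    mextDeriv α x = 0 := by
  have h0 : extDerivWithin (α.inChart x) (Set.range I) (extChartAt I x x) = 0 := by
    rw [extDerivWithin, fderivWithin_zero_of_not_differentiableWithinAt h,
      ← ContinuousAlternatingMap.alternatizeUncurryFinCLM_apply, map_zero]
  simp only [mextDeriv, h0]
  ext v
  simp

/-- Hence a form whose chart representatives are nowhere differentiable is "closed": `IsClosedForm`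
must never be detached from `IsSmoothForm` (the crux assumes both, so it is protected). [folklore] -/
theorem isClosedForm_of_forall_not_differentiableWithinAt (α : MForm I M F k)
    (h : ∀ x, ¬ DifferentiableWithinAt ℝ (α.inChart x) (Set.range I) (extChartAt I x x)) :
    IsClosedForm α := by
  funext x
  exact mextDeriv_eq_zero_of_not_differentiableWithinAt α x (h x)

end Semantics

/-! ## §2 Numerical resistance (the door saturates every known inequality) -/

section Numerics

/-- DOOR NUMERICS. With `χ = 2 − 2b₁ + b₂`, `σ = b⁺ − b⁻`, `K² = 2χ + 3σ`, `4χ_h = χ + σ`: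
`(b₁, b₂) = (2, 1)` and `b⁺ ≥ 1` (`[s]² > 0`) force `(b⁺, b⁻, χ, σ, K², χ + σ) = (1, 0, −1, 1, 1, 0)`.
In particular `b⁻ = 0`: the door is minimal, and not rational/ruled (ruled over `T²` has `b₂ = 2`),
so `κ = 2` with `χ_h = 0` — the open cell. [folklore] -/
theorem door_numerics {b1 b2 bp bm : ℤ} (h1 : b1 = 2) (h2 : b2 = 1) (hsum : bp + bm = b2)
    (hbp : 1 ≤ bp) (hbm : 0 ≤ bm) :
    bp = 1 ∧ bm = 0 ∧ 2 - 2 * b1 + b2 = -1 ∧ bp - bm = 1 ∧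
      2 * (2 - 2 * b1 + b2) + 3 * (bp - bm) = 1 ∧ (2 - 2 * b1 + b2) + (bp - bm) = 0 := by
  omega

/-- LIU'S TABLE (Liu 1996, MRL 3: a minimal symplectic 4-manifold with `b⁺ = 1` which is not
rational or ruled has `K² ≥ 0`). With `b⁺ = 1`, `K² = 9 − 4b₁ − b⁻`, and `b₁` even (`χ + σ ≡ 0 (4)`
for almost-complex), `K² ≥ 0` leaves exactly `b₁ = 0, b⁻ ≤ 9` and `b₁ = 2, b⁻ ≤ 1`. The door
`(b₁, b⁻) = (2, 0)` is the extremal admissible cell (`K² = 1`): Liu's inequality is SATISFIED, so the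
`b⁺ = 1` Seiberg–Witten technology in the tree of ideas yields a genus-2 curve, not a contradiction.
[cite: Liu1996] -/
theorem liu_table {b1 bm K2 : ℤ} (hK : K2 = 9 - 4 * b1 - bm) (hK0 : 0 ≤ K2) (heven : Even b1)
    (hb1 : 0 ≤ b1) (hbm : 0 ≤ bm) : (b1 = 0 ∧ bm ≤ 9) ∨ (b1 = 2 ∧ bm ≤ 1) := by
  rcases heven with ⟨k, rfl⟩
  omega

/-- KOTSCHICK'S BOUND IS ATTAINED-AT-THE-BOUNDARY, NOT VIOLATED: `q^SYMP(Γ) ≥ −6/5 (b₁(Γ) − 1)`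
(Kotschick, PAMS 134 (2006), Thm 2, for `Γ` not a surface group) reads `5χ ≥ −6` at `b₁ = 2`, i.e.
`χ ≥ −1` over `ℤ` — exactly the door's Euler characteristic. His proof of Thm 1 ends with
"`q^SYMP(F₂) ≥ −1`, which is true because `χ(X) = −2 + b₂(X) ≥ −1`"; whether `−1` is attained is the
crux for `π₁ = F₂`. [cite: arXiv:math/0504578, Thm 1–2 and last paragraph] -/
theorem kotschick_boundary {χ : ℤ} (h : -6 * ((2 : ℤ) - 1) ≤ 5 * χ) : -1 ≤ χ := by
  omega

/-- THE COVER TOWER. A connected `d`-fold cover `X_d` of a door is symplectic with `χ = −d`, `σ = d`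
(multiplicativity), hence `χ + σ = 0` again, which with `χ = 2 − 2b₁' + b⁺' + b⁻'`, `σ = b⁺' − b⁻'`
gives `b⁺' = b₁' − 1`, `b⁻' = b₁' − 1 − d`, so `b₁(X_d) ≥ d + 1` and `K²(X_d) = 2χ + 3σ = d > 0 =
9χ_h`: Taubes' `K² ≥ 0` (`b⁺ > 1`) holds with slack; the conjectural symplectic BMY `K² ≤ 9χ_h` and
Gompf's `χ ≥ 0` fail — but both are open for `κ = 2`. [folklore] -/
theorem cover_tower {d b1' bp' bm' : ℤ} (hχ : 2 - 2 * b1' + (bp' + bm') = -d) (hσ : bp' - bm' = d)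
    (hbm : 0 ≤ bm') :
    bp' = b1' - 1 ∧ bm' = b1' - 1 - d ∧ d + 1 ≤ b1' ∧ 2 * (-d) + 3 * d = d := by
  omega

/-- Consequence for `π₁`: NO subgroup of finite index `d ≥ 2` of `π₁(door)` has `b₁ ≤ d`. So
`π₁ ≠ ℤ²`, `π₁` is not virtually (`b₁`-bounded), not `F₂ × G` with `G ≠ 1` finite (the subgroup
`F₂` has index `|G|` and `b₁ = 2`); `F₂` itself satisfies every constraint with equality
(`b₁` of an index-`d` subgroup of `F₂` is `d + 1`), whence `b⁻(X_d) = 0` for every cover if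
`π₁ = F₂`: a tower of positive-definite symplectic manifolds with `b⁺ = d`. [folklore] -/
theorem no_small_b1_cover {d b1' bp' bm' : ℤ} (hχ : 2 - 2 * b1' + (bp' + bm') = -d)
    (hσ : bp' - bm' = d) (hbm : 0 ≤ bm') (hsmall : b1' ≤ d) : False := by
  omega

/-- `b⁻ = 0`, `b⁺ = 1`: on `H₂/torsion = ℤh` the form is `c ↦ c²`. No rationally essential class has
square `≤ 0`: no Lefschetz fibration over a curve lives on a door (fibre class isotropic and
essential), no essential square-zero torus (no fibre sum / knot surgery starts or ends at a door),
every Lagrangian torus in a door is rationally null-homologous. [folklore] -/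
theorem posDef_no_isotropic {c : ℤ} (h : c * c ≤ 0) : c = 0 := by
  nlinarith

/-- Adjunction on a door (`K = h`, SW chamber-free because `H¹ ∪ H¹` is torsion): an embedded surface
in class `c·h ≠ 0` has `2g − 2 ≥ c² + |c| > 0`, so genus `≥ 2` — no essential spheres or tori; the
genus-2 curve `B = K` is genus-minimising. [folklore] -/
theorem adjunction_no_tori {c : ℤ} (hc : c ≠ 0) : 0 < c * c + |c| := by
  rcases le_or_gt 0 c with h | h
  · rw [abs_of_nonneg h]; positivity
  · rw [abs_of_neg h]; nlinarith

end Numerics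

/-! ## §3 Constructions that cannot reach the door -/

section Constructions

/-- RATIONAL-BLOWDOWN HOSTS. If a `C_p`-type rational blowdown (removes a negative definite plumbing
of `b₂ = p − 1`, Euler characteristic `p`, glues a ℚ-homology ball: `χ ↦ χ − (p − 1)`,
`σ ↦ σ + (p − 1)`, `b₁` unchanged across the ℚHS³) lands in the class `(χ, σ) = (−1, 1)` with
`b⁺ = b₁ − 1`, then the host has `b⁺ = b₁ − 1`, `b⁻ = b₁ + p − 3` and `K² = 2 − p`; for `p ≥ 3`
this is negative, so (Taubes for `b⁺ > 1`, Liu for `b⁺ = 1`) the host is a blow-up of a minimal `Y`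
with `(χ_h, K²) = (0, j)`, `j ≥ 0`, or of a ruled surface. [folklore] -/
theorem blowdown_host_numerics {p b1 bp bm : ℤ}
    (hχ : 2 - 2 * b1 + (bp + bm) = -1 + (p - 1)) (hσ : bp - bm = 1 - (p - 1)) :
    bp = b1 - 1 ∧ bm = b1 + p - 3 ∧ 2 * (2 - 2 * b1 + (bp + bm)) + 3 * (bp - bm) = 2 - p := by
  omega

/-- NO BLOW-DOWN CONFIGURATION IN `Y # k\overline{ℂP²}` FOR THE KNOWN HOSTS `Y`. Model the span of
sphere classes as `ℚF ⊕ ℚᵏ` (`F` the fibre of an `S²`-bundle over `T²`, or absent — coefficient `0`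
— for aspherical `Y`, whose spheres lift to the universal cover and have classes in `⊕ ℚEⱼ`), with
intersection form `Q(bF + Σ cⱼEⱼ) = −Σ cⱼ²` (`F² = F·Eⱼ = 0`, `Eᵢ·Eⱼ = −δᵢⱼ`). Any `k + 1` such
classes admit a non-trivial rational combination with vanishing `E`-part, on which `Q = 0`; so they
never span a negative definite lattice of rank `k + 1 ≤ b⁻(host)`. Hence no plumbing of embedded
spheres in a blow-up of a known `χ = σ = 0` symplectic manifold or of a ruled surface over `T²` can be
rationally blown down to `b⁻ = 0`: the door is not a rational blowdown of anything known. [folklore] -/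
theorem sphereSpan_not_negDef (k : ℕ) (v : Fin (k + 1) → ℚ × (Fin k → ℚ)) :
    ∃ a : Fin (k + 1) → ℚ, a ≠ 0 ∧ (∑ i, a i • v i).2 = 0 := by
  have hli : ¬ LinearIndependent ℚ (fun i ↦ (v i).2) := by
    intro hli
    have := hli.fintype_card_le_finrank
    simp at this
  obtain ⟨g, hg, i, hi⟩ := Fintype.not_linearIndependent_iff.mp hli
  refine ⟨g, fun h ↦ hi (by simp [h]), ?_⟩
  rw [Prod.snd_sum]
  simpa using hg

/-- The quadratic form of the model lattice `ℚF ⊕ ℚᵏ`: `Q(b, c) = −Σ cⱼ²`. [folklore] -/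
def hostForm (k : ℕ) (w : ℚ × (Fin k → ℚ)) : ℚ := -∑ j, w.2 j ^ 2

/-- Corollary in the form used in §3: no family of `k + 1` classes in `ℚF ⊕ ℚᵏ` is negative definite
for `hostForm`. [folklore] -/
theorem not_negDef_hostForm (k : ℕ) (v : Fin (k + 1) → ℚ × (Fin k → ℚ)) :
    ¬ ∀ a : Fin (k + 1) → ℚ, a ≠ 0 → hostForm k (∑ i, a i • v i) < 0 := by
  intro h
  obtain ⟨a, ha, h0⟩ := sphereSpan_not_negDef k v
  have := h a ha
  simp [hostForm, h0] at this

/-- NOT A QUOTIENT, NOT A COVER, NOT A BUNDLE (cycle 2). `χ(door) = −1`. A connected `d`-fold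
unbranched cover `X → Y` has `χ(X) = d·χ(Y)`, so a door is the total space of a non-trivial covering
of NOTHING (`d·χ(Y) = −1 ⇒ d = 1`): it admits no free action of a non-trivial finite group and
(χ ≠ 0) no fixed-point-free circle action (gen 1: actions with fixed points are Hamiltonian, hence
`N` rational/ruled); and since `χ` is ODD it is not the total space of any smooth fibre bundle with
closed fibre and base of positive dimension (`χ = χ(F)·χ(B)` with one factor even or zero). The
other direction is `cover_tower`: a door is covered only by `χ = −d` manifolds. [folklore] -/
theorem not_a_quotient {d χY : ℤ} (hd : 0 < d) (h : d * χY = -1) : d = 1 := by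
  rcases lt_trichotomy χY (-1) with hlt | rfl | hgt
  · nlinarith
  · linarith
  · have : 0 ≤ χY := by linarith
    nlinarith

/-- NOT A CYCLIC BRANCHED COVER (cycle 2). If `π : N → Y` is a `d`-fold cyclic cover branched along
an embedded (possibly disconnected) symplectic surface `B ⊂ Y` with `[B] = d·L` (the symplectic
branched covers of Gompf / Auroux), Hurwitz gives `K_N = π^*(K_Y + (d − 1)L)` modulo torsion, so
`K_N² = d·(K_Y + (d − 1)L)²` is DIVISIBLE BY `d`; unbranched: `K_N² = d·K_Y²`. A door has
`K² = 2χ + 3σ = 1`, hence `d = 1`: no cyclic (branched or unbranched) covering construction over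
ANY base reaches the door — independently of gen 1's parity exclusion of double branched covers
(`χ = 2χ(Y) − χ(B)` even). Non-cyclic Galois covers escape only through fractional
`(K_Y + Δ)² = 1/|G|`. [folklore] -/
theorem not_cyclic_branched_cover {d m : ℤ} (hd : 0 < d) (hK : d * m = 1) : d = 1 :=
  Int.eq_one_of_dvd_one hd.le ⟨m, hK.symm⟩

end Constructions

/-! ## §4 The filling reformulation -/

section Filling

/-- FILLING NUMERICS. Glue a strong filling `W` of `(Y_{2,−1}, ξ_can)` to the cap `D = D(Σ₂, +1)`
(`χ(D) = −2`, `σ(D) = 1`, `χ(Y) = 0`; `H₁(Y) → H₁(D)` is an isomorphism because `e = ±1` kills the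
fibre, whence `b₁(W ∪ D) = b₁(W)` by Mayer–Vietoris; Novikov additivity for `σ`): `X = W ∪ D` has
`χ = χ(W) − 2`, `σ = σ(W) + 1`, `b₁ = b₁(W)`. Then `X` is a door iff `(b₁, χ, σ)(W) = (2, 1, 0)`.
The `b₁(W) = 0` fillings with `χ = 5` would give a symplectic (fake) `ℂP²` with a genus-2 curve of
square 1 — excluded by adjunction (`K = ∓3h`: genus 0 or 3). [folklore] -/
theorem filling_numerics {χW σW b1W χX σX b1X b2X : ℤ} (hχ : χX = χW - 2) (hσ : σX = σW + 1)
    (hb1 : b1X = b1W) (hχX : χX = 2 - 2 * b1X + b2X) :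
    (b1X = 2 ∧ b2X = 1 ∧ σX = 1) ↔ (b1W = 2 ∧ χW = 1 ∧ σW = 0) := by
  omega

end Filling

/-! ## §5 Load-bearing hypotheses -/

section LoadBearing

/-- The crux with `[CompactSpace N]` deleted. FALSE: `T*T² ≅ (ℝ² ∖ 0) × (ℝ² ∖ 0) ⊂ ℝ⁴` with the
restriction of `dx₀ ∧ dx₁ + dx₂ ∧ dx₃` is an open (hence `ℝ⁴`-charted, `C^∞`, Hausdorff, second
countable, connected, NON-compact) symplectic 4-manifold homotopy equivalent to `T²`, so
`(b₁, b₂) = (2, 1)`. [folklore] -/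
def WithoutCompact : Prop :=
  ∀ (N : Type) [TopologicalSpace N] [T2Space N] [SecondCountableTopology N]
    [ConnectedSpace N] [ChartedSpace (EuclideanSpace ℝ (Fin 4)) N] [IsManifold (𝓡 4) ∞ N]
    (s : MForm (𝓡 4) N ℝ 2), IsSymplecticMForm s → ¬ BettiDoor N

/-- **Compactness is load-bearing** (formal, cycle 2 closes the gen-1 `proof_wanted`): the tree
theorem `Summit.SmoothPoincare4.SmoothPoincare4.Theorems.NoGenusTwoDoor.Negative.noGenusTwoDoor_false_without_compact`
(p74187; witness `(ℝ² ∖ 0)² ⊂ ℝ⁴` with `dx₀∧dx₁ + dx₂∧dx₃`, `U ≃ₕ T²`, `b₁ = 2`, `b₂ = 1`) is this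
statement with `IsSymplecticMForm`/`BettiDoor` unfolded; imported and re-bundled here. [folklore] -/
theorem false_withoutCompact : ¬ WithoutCompact := by
  intro h
  refine Summit.SmoothPoincare4.SmoothPoincare4.Theorems.NoGenusTwoDoor.Negative.noGenusTwoDoor_false_without_compact ?_
  intro N _ _ _ _ _ _ s h1 h2 h3
  exact h N s ⟨h1, h2, h3⟩

/-- The crux with `IsClosedForm s` deleted. FALSE on paper: `(S¹ × S³) # (S¹ × S³) # ℂP²` has
`(b₁, b₂, χ, σ) = (2, 1, −1, 1)`, `χ + σ ≡ 0 (4)` and `c = h`, `c² = 1 = 2χ + 3σ`, `c ≡ w₂ (2)`, so it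
is almost complex (Wu; Hirzebruch–Hopf) and carries a smooth everywhere non-degenerate 2-form. It is
NOT symplectic, but only gauge theory says so: its numerics ARE a door's (`π₁ = F₂`; the double cover
`3(S¹ × S³) # 2ℂP²` has `(b₁, b⁺, b⁻) = (3, 2, 0)`, exactly as `cover_tower` demands), and the
symplectic structure is excluded because that cover is a connected sum of two pieces with `b⁺ ≥ 1`,
whose Seiberg–Witten invariants vanish (`b⁺ = 2 > 1`), against Taubes' `SW(K) = ±1`. So the
almost-complex/numerical shadow of the crux is FALSE and the crux is genuinely about `ds = 0`.
Not formalisable here (no connected sums, almost-complex structures or SW theory in the tree). [folklore] -/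
def WithoutClosed : Prop :=
  ∀ (N : Type) [TopologicalSpace N] [T2Space N] [SecondCountableTopology N] [CompactSpace N]
    [ConnectedSpace N] [ChartedSpace (EuclideanSpace ℝ (Fin 4)) N] [IsManifold (𝓡 4) ∞ N]
    (s : MForm (𝓡 4) N ℝ 2), IsSmoothForm s →
      (∀ x (v : TangentSpace (𝓡 4) x), v ≠ 0 → ∃ w, s x ![v, w] ≠ 0) → ¬ BettiDoor N

/-- Closedness is load-bearing (paper witness: the almost-complex `(S¹ × S³) # (S¹ × S³) # ℂP²`). [folklore] -/
proof_wanted false_withoutClosed : ¬ WithoutClosed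

/-- The crux with non-degeneracy deleted. FALSE on paper: `s = 0` on `(S¹ × S³) # (S¹ × S³) # ℂP²`
(or on any closed smooth 4-manifold with `(b₁, b₂) = (2, 1)`). [folklore] -/
def WithoutNondegenerate : Prop :=
  ∀ (N : Type) [TopologicalSpace N] [T2Space N] [SecondCountableTopology N] [CompactSpace N]
    [ConnectedSpace N] [ChartedSpace (EuclideanSpace ℝ (Fin 4)) N] [IsManifold (𝓡 4) ∞ N]
    (s : MForm (𝓡 4) N ℝ 2), IsSmoothForm s → IsClosedForm s → ¬ BettiDoor N

/-- Non-degeneracy is load-bearing (paper witness: the zero form on any closed `(2, 1)` 4-manifold;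
needs a closed smooth 4-manifold with `(b₁, b₂) = (2, 1)` in the tree — none is constructed). [folklore] -/
proof_wanted false_withoutNondegenerate : ¬ WithoutNondegenerate

/-- The zero form is smooth and closed (tree lemmas), so `WithoutNondegenerate` reduces to pure
topology: "no closed `ℝ⁴`-charted 4-manifold has `(b₁, b₂) = (2, 1)`" — false, but only the reduction
is formal here. [folklore] -/
theorem withoutNondegenerate_iff_topological :
    WithoutNondegenerate ↔
      ∀ (N : Type) [TopologicalSpace N] [T2Space N] [SecondCountableTopology N] [CompactSpace N]
        [ConnectedSpace N] [ChartedSpace (EuclideanSpace ℝ (Fin 4)) N] [IsManifold (𝓡 4) ∞ N],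
        ¬ BettiDoor N := by
  constructor
  · intro h N _ _ _ _ _ _ _
    exact h N 0 isSmoothForm_zero mextDeriv_zero
  · intro h N _ _ _ _ _ _ _ s _ _
    exact h N

end LoadBearing

/-! ## §7 Reformulations of the crux (cycle 2) -/

section Reformulations

/-- `b₁ = 2` FORM. For a closed symplectic 4-manifold with `b₁ = 2`: `χ = b₂ − 2` and
`b₂ ≥ b⁺ ≥ 1`, so `χ ≥ −1` with equality iff `b₂ = 1`. Hence
NoGenusTwoDoor ⟺ "every closed symplectic 4-manifold with `b₁ = 2` has `χ ≥ 0`" ⟺ "… has `b₂ ≥ 2`"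
⟺ "`q^SYMP(G) ≥ 0` for every finitely presented `G` with `b₁(G) = 2`" (Kotschick's invariant; his
Thm 1 is `q^SYMP ≥ −1` here, the door being the case of equality). [folklore] -/
theorem b1two_form {b2 bp χ : ℤ} (hχ : χ = 2 - 2 * 2 + b2) (hbp : 1 ≤ bp) (hb : bp ≤ b2) :
    -1 ≤ χ ∧ (χ = -1 ↔ b2 = 1) := by
  omega

/-- `(2, 2)` FORM. Every closed symplectic 4-manifold with `b₁ = b₂ = 2` has
`(b⁺, b⁻, χ, σ, K²) = (1, 1, 0, 0, 0)` (`b⁺ ≥ 1`; `1 − b₁ + b⁺` even) — the numerics of `T² × S²`.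
`door # \overline{ℂP²}` is such a manifold (`blowup_door_numerics`), with ODD form `⟨1⟩ ⊕ ⟨−1⟩`,
`K = h + e` primitive isotropic, `h − e` a square-0 genus-2 class, and Kodaira dimension 2;
conversely a NON-minimal symplectic `(2, 2)`-manifold blows down to `(b₁, b₂) = (2, 1)`, which is not
rational/ruled (ruled over `T²` has `b₂ = 2`), i.e. to a door. Hence
NoGenusTwoDoor ⟺ "every closed symplectic 4-manifold with `b₁ = b₂ = 2` is minimal" (smoothly =
symplectically minimal, T.-J. Li 1999). The known `(2, 2)` symplectic manifolds — `T² × S²` (even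
form), `S² ×~ T²` (its square-`(−1)` section is a torus), `T²`-bundles over `T²` with `b₁ = 2` and
`S¹ × M_K` (aspherical), Baldridge's `X_g` (§10; a circle bundle over a mapping torus, hence
aspherical; κ ≤ 1, `K² = 0`, `K = (2g − 2)T`) — are all minimal (the aspherical ones contain no
essential spheres at all; note that a blown-up door would have the SAME numerics `K² = 0`,
`K·ω > 0` as a κ = 1 manifold, so minimality, not numerics, is what separates them). A door is thus
"an exotic, non-minimal symplectic `S² ×~ T²` of
Kodaira dimension 2". [folklore] -/
theorem b1two_b2two_form {bp bm : ℤ} (hsum : bp + bm = 2) (hbp : 1 ≤ bp) (hbm : 0 ≤ bm)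
    (hpar : Even (1 - 2 + bp)) :
    bp = 1 ∧ bm = 1 ∧ 2 - 2 * 2 + (bp + bm) = 0 ∧ bp - bm = 0 ∧
      2 * (2 - 2 * 2 + (bp + bm)) + 3 * (bp - bm) = 0 := by
  rcases hpar with ⟨k, hk⟩
  omega

/-- The blow-up of a door: `(b⁺, b⁻, K²) = (1, 0, 1) ↦ (1, 1, 0)`, `χ: −1 ↦ 0`, `σ: 1 ↦ 0`. [folklore] -/
theorem blowup_door_numerics {bp bm K2 : ℤ} (h : bp = 1 ∧ bm = 0 ∧ K2 = 1) :
    bp + (bm + 1) = 2 ∧ K2 - 1 = 0 ∧ 2 - 2 * 2 + (bp + (bm + 1)) = 0 ∧ bp - (bm + 1) = 0 := by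
  omega

/-- SYMPLECTIC CASTELNUOVO–DE FRANCHIS FORM. For a minimal symplectic 4-manifold with `b⁺ = 1` of
Kodaira dimension 2 (`K² ≥ 1`; Liu: `K² = 9 − 4b₁ − b⁻`, `b₁` even): either `b₁ = 0` (`χ_h = 1`:
Godeaux/Barlow/fake-plane numerics) or `(b₁, b⁻, K²) = (2, 0, 1)` — the door. So
NoGenusTwoDoor ⟺ "κˢ = 2 ∧ b⁺ = 1 ⇒ b₁ = 0" ⟺ "κˢ = 2 ∧ b⁺ = 1 ⇒ χ_h = 1": the symplectic shadow
of `χ(𝒪_S) ≥ 1` for complex surfaces of general type — which is exactly why no Kähler door exists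
and why nothing weaker than a holomorphic-Euler-characteristic positivity statement for κˢ = 2 is
known to imply the crux. [cite: Liu1996] -/
theorem castelnuovo_form {b1 bm K2 : ℤ} (hK : K2 = 9 - 4 * b1 - bm) (hK1 : 1 ≤ K2)
    (heven : Even b1) (hb1 : 0 ≤ b1) (hbm : 0 ≤ bm) :
    b1 = 0 ∨ (b1 = 2 ∧ bm = 0 ∧ K2 = 1) := by
  rcases heven with ⟨k, rfl⟩
  omega

/-- GOMPF-AT-`b⁺ = 1` FORM (cycle 3). For a closed MINIMAL symplectic 4-manifold with `b⁺ = 1` that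
is not rational or ruled, Liu's `K² = 9 − 4b₁ − b⁻ ≥ 0` with `b₁` even leaves `χ = 3 − 2b₁ + b⁻ < 0`
only at `(b₁, b⁻) = (2, 0)` — the door; a non-minimal one has `χ = χ(minimal model) + k ≥ −1 + 1`.
Hence NoGenusTwoDoor ⟺ "every closed symplectic 4-manifold with `b⁺ = 1` which is not rational or
ruled has `χ ≥ 0`": the crux is EXACTLY the `b⁺ = 1` case of Gompf's `χ ≥ 0` conjecture (general
case recorded open by Kotschick 2006; the Lefschetz-fibred `b⁺ = 1` sub-case is Stipsicz 2002
Cor. 3.5). Conversely a door violates it. [cite: Liu1996] -/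
theorem gompf_bPlusOne_form {b1 bm : ℤ} (hK0 : 0 ≤ 9 - 4 * b1 - bm) (heven : Even b1)
    (hb1 : 0 ≤ b1) (hbm : 0 ≤ bm) (hχ : 2 - 2 * b1 + (1 + bm) < 0) : b1 = 2 ∧ bm = 0 := by
  rcases heven with ⟨k, rfl⟩
  omega

end Reformulations

/-! ## §8 The pencil family (card albanese-isotropic-pencil) -/

section Pencils

/-- DOOR PENCILS, re-derived. A Donaldson pencil of degree `a ≥ 1` on a door (`[F] = a·h`, `a²`
base points) blows up to a genus-`g` Lefschetz fibration `X = N # a²\overline{ℂP²} → S²` with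
`2g − 2 = F² + K_X·F = a² + a`, `χ(X) = a² − 1 = 4 − 4g + n`, `σ(X) = 1 − a² = −b⁻(X)` (all of `H₂⁻`
carried by the `a²` exceptional sections), `K_X² = 1 − a²`, `χ_h = 0`; so `n = 3a² + 2a − 1`
singular fibres, Hodge degree `λ = g − 1`, `K²_{X/S²} = K_X² + 8(g − 1) = 3a² + 4a + 1`, Noether
`12λ = K²_{X/S²} + n`, slope `6 + 2/a`: `(a; g, n, σ) = (1; 2, 4, 0), (2; 4, 15, −3), (3; 7, 32, −8),
(4; 11, 55, −15), …`. [folklore] -/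
theorem pencil_numerics {a g n : ℤ} (hg : 2 * g - 2 = a ^ 2 + a)
    (hn : a ^ 2 - 1 = 4 - 4 * g + n) :
    n = 3 * a ^ 2 + 2 * a - 1 ∧ 12 * (g - 1) = (1 - a ^ 2 + 8 * (g - 1)) + n ∧
      1 - a ^ 2 + 8 * (g - 1) = 3 * a ^ 2 + 4 * a + 1 := by
  refine ⟨by linarith, by linarith, by linarith⟩

/-- The family passes the standard Lefschetz-fibration inequalities for EVERY `a ≥ 1`:
`5n ≥ 8g − 4` (Stipsicz / Braungardt–Kotschick), Ozbagci's `σ ≤ n − 4g + 4`, `b₁(X) = 2 ≤ g`, and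
the slope bounds `4(g − 1) < K²_{X/S²} < 12(g − 1)` (slope `6 + 2/a` strictly between Xiao's
`4 − 4/g` and `12`). Counting inequalities alone kill no
member (as the card concedes for `a ≥ 3`); the card's bet is the section-saturation `b⁻ = a²`
combined with isotropy, which these numerics do not see. [folklore] -/
theorem pencil_passes_LF_inequalities {a g n σ : ℤ} (ha : 1 ≤ a) (hg : 2 * g - 2 = a ^ 2 + a)
    (hn : n = 3 * a ^ 2 + 2 * a - 1) (hσ : σ = 1 - a ^ 2) :
    8 * g - 4 ≤ 5 * n ∧ σ ≤ n - 4 * g + 4 ∧ 2 ≤ g ∧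
      4 * (g - 1) < 3 * a ^ 2 + 4 * a + 1 ∧ 3 * a ^ 2 + 4 * a + 1 < 12 * (g - 1) := by
  have ha2 : 1 ≤ a ^ 2 := by nlinarith
  refine ⟨by nlinarith, by nlinarith, by nlinarith, by nlinarith, by nlinarith⟩

/-- The `a = 1` member is dead by hand: `(g, n, σ) = (2, 4, 0)`, while a genus-2 Lefschetz
fibration over `S²` with `n₀` non-separating and `n₁` separating singular fibres has
`5σ = −(3n₀ + n₁)` (Matsumoto; Endo 2000), so `σ = 0` forces `n₀ = n₁ = 0 ≠ 4`. Equivalently a door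
carries no symplectic genus-2 pencil with one base point / `door # \overline{ℂP²}` (§7) is not
genus-2 Lefschetz fibred over `S²`. Donaldson pencils have large degree, so this kills nothing else;
`a = 2` (`g = 4`, `n = 15`, `σ = −3`, four disjoint `(−1)`-sections, `b₁ = 2`) is the first live
member and, if it EXISTS, is a door after blow-down (the card's cheapest falsifier on both sides).
[cite: doi:10.1007/s002080050012] -/
theorem pencil_a_one_dead {n0 n1 σ : ℤ} (h0 : 0 ≤ n0) (h1 : 0 ≤ n1) (hσ : 5 * σ = -(3 * n0 + n1))
    (hsum : n0 + n1 = 4) (hzero : σ = 0) : False := by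
  omega

/-- Stipsicz's `b⁺ = 1` Lefschetz inequalities are passed too (Topology Appl. 117 (2002) 9–21,
doi:10.1016/s0166-8641(00)00105-x, READ): Lemma 3.2 — a relatively minimal non-trivial genus-`g`
Lefschetz fibration over `S²` has `4(b₁ − g) + b⁻ ≤ 5b⁺` — reads `4(2 − g) + a² ≤ 5` for the door
pencils (relatively minimal: the exceptional curves are sections), slack exactly `(a + 1)²`; and his
Thm 2.6 input `c₁²(X #_f X) = 10b⁺ − 2b⁻ − 8(b₁ − g) ≥ 0` reads `2(a + 1)² ≥ 0`. The same paper
states the crux as an open belief (Remark 3.4, p. 15): "The existence of a symplectic 4-manifold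
with `b₂⁺(X) = 1`, `b₂⁻(X) = 0` and `b₁(X) = 2` would contradict Conjecture 2.10 [Gompf's `χ ≥ 0`] —
it is the author's belief that such (symplectic) 4-manifold does not exist, although he is unaware
of a proof"; his Cor. 3.5 proves `χ ≥ 0` for `b⁺ = 1` manifolds that ARE genus-`g ≥ 2` Lefschetz
fibred over `S²` (the fibre is an essential square-zero class, so `b₂ ≥ 2`) — a door is only
Lefschetz PENCILLED (`posDef_no_isotropic`). [cite: doi:10.1016/s0166-8641(00)00105-x] -/
theorem pencil_passes_stipsicz {a g : ℤ} (hg : 2 * g - 2 = a ^ 2 + a) :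
    5 * 1 - (4 * (2 - g) + a ^ 2) = (a + 1) ^ 2 ∧
      10 * 1 - 2 * a ^ 2 - 8 * (2 - g) = 2 * (a + 1) ^ 2 :=
  ⟨by linear_combination 2 * hg, by linear_combination 4 * hg⟩

end Pencils

/-! ## §9 The complement of the canonical curve (cards liouville-genus-two-complement,
semidefinite-filling-door; extends §4) -/

section Complement

/-- COMPLEMENT BOOKKEEPING, re-derived. `B ⊂ N` the Taubes genus-2 curve, `B² = 1`, `W = N ∖ ν(B)`,
`Y = ∂W` the Euler-number-`(−1)` circle bundle over `Σ₂` (`b₁(Y) = 4`; the fibre is null-homologous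
since `|e| = 1`, so `H₂(N; ℚ) → H₁(Y; ℚ)` vanishes). With `r := rank(H₁(Y; ℚ) → H₁(W; ℚ)) ∈ {0, 1, 2}`
(`= 2 − κ_B` of the cards), Mayer–Vietoris gives `b₁(W) = 2`, `H₁(W; ℚ) ≅ H₁(N; ℚ)`,
`rank(H₁(B) → H₁(N)) = r` with isotropic image of `H¹(N) → H¹(B)` (cup square torsion; Lagrangian
iff `r = 2`), `b₃(W) = b₁(W, Y) = 2 − r`, `χ(W) = χ(N) − χ(B) = 1`, hence `b₂(W) = 4 − r`;
`b⁺(W) = b⁻(W) = 0` (`b⁺(N) = 1` lives on `B`, `b⁻(N) = 0`), so `Q_W ≡ 0`, `H₂(W; ℚ) = im H₂(Y; ℚ)`;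
`[ω]|_W = 0` because `b₂(N) = 1` forces `[ω] = λ·PD[B]` — `W` is an EXACT strong filling of
`(Y_{2,−1}, ξ_BW)`, Weinstein only if `r = 2` (`b₃ = 0`). Both extreme values of `r` occur smoothly
on the almost-complex near-door `(S¹ × S³) # (S¹ × S³) # ℂP²` (genus-2 surface in the class `h` inside
a ball: `r = 0`; tubed to the `S¹ × pt` tori: `r = 2`), so `r` is not decided by topology. [folklore] -/
theorem complement_bookkeeping {r b1W b2W b3W χW : ℤ} (hr0 : 0 ≤ r) (hr2 : r ≤ 2)
    (hb1 : b1W = 2) (hb3 : b3W = 2 - r) (hχ : χW = 1) (hχ' : χW = 1 - b1W + b2W - b3W) :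
    b2W = 4 - r ∧ 2 ≤ b2W ∧ b2W ≤ 4 ∧ (b3W = 0 ↔ r = 2) := by
  omega

end Complement

/-! ## §10 Idea-level refutations found in print (cycle 2; paper witnesses, arithmetic formal) -/

section IdeaLevel

/-- **THE CUP-DEGENERATE `b⁺ = 1, b₁ = 2` REGIME IS INHABITED (refutes the strengthening C⁺⁺ of card
picard-loop-classes: "every closed symplectic 4-manifold with b⁺ = 1 and b₁ = 2 has non-torsion cup
product Λ²H¹ → H²" is FALSE).** Baldridge, *New symplectic 4-manifolds with b⁺ = 1*, Math. Ann. 333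
(2005) 633–643, doi:10.1007/s00208-005-0684-9 = arXiv:math/0311157, READ in full: for every `g ≥ 1`
the circle bundle `X_g → Y_φ` over the mapping torus of
`φ = (T_{b_g}T_{a_g}⁻¹)⋯(T_{b₂}T_{a₂}⁻¹)·T_{a₁} : Σ_g → Σ_g` (`dim ker(φ^* − 1) = 1`, so
`b₁(Y_φ) = 2`), with Euler class `[α ∧ θ]`, carries `ω = π^*Ω + π^*θ ∧ η` and has `b₁ = 2`, `b₂ = 2`,
`Q = [[0, 1], [1, d]]` (this lemma: determinant `−1`, so indefinite: `b⁺ = b⁻ = 1`, `σ = 0`),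
`K = (2g − 2)[π^*Ω]`, `K² = 0`, `K·[ω] = 2g − 2` (κ = 1 for `g ≥ 2`; κ = 0, `K = 0` for `g = 1`), and
`[π^*θ] ∪ H¹(X_g; ℤ) = 0` (his §4) — the cup product on `H¹` VANISHES identically, every Li–Liu
wall-crossing number is `0` (his §5, Thm 2), the SW invariant `(𝔰⁻² − 3 + 𝔰²)^{g−1}` is a smooth
invariant, `X_g` is not of Lefschetz type and carries no psc metric. Consequences: (i) cup-torsion
at `b⁺ = 1, b₁ = 2` does NOT force κ = 2, so the loop ("Picard-torus") wall-crossing term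
`WC(𝔰)(u^{ind−1}γ₁γ₂) = ±1` floods `X_g` as well (every `𝔰` with `ind ≥ 1`) and coexists with an
honest symplectic manifold: a kill of the door through it must use door-specific input (`K² = 1`,
i.e. `d(nK) = n² − n > 0`, whereas on `X_g` all multiples of `K` have `d = 0`; the rigid square-1
genus-2 curve; the exact complement) — precisely the κ ≤ 1 laboratory that card searched for
(Baldridge–Li 2005, Li 2006) and did not find; (ii) `X_g` is minimal (aspherical), consistent
with §7's `(2, 2)` form of the crux. [cite: arXiv:math/0311157 Thm 1, §3–§5] -/
theorem baldridge_lab_form (d : ℤ) : Matrix.det !![(0 : ℤ), 1; 1, d] = -1 := by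
  rw [Matrix.det_fin_two_of]
  ring

/-- **EXACT FILLINGS OF THE GENUS-2 BOOTHBY–WANG BOUNDARY WITH `b₁ = 2` EXIST (corrects the zoo of
card liouville-genus-two-complement — "b₁ ∈ {0, 4}", "the door would be the UNIQUE filling type with
b₁ = 2" — and item (3) of card semidefinite-filling-door).** In `X_k = (T² × S²) # k\overline{ℂP²}`
(`S = T² × pt`, `F = pt × S²`, `S² = F² = 0`, `S·F = 1`, `K = −2S + ΣEᵢ`; `b₁ = 2`, `b⁺ = 1`,
`b⁻ = k + 1`) a class `β = dS + bF − ΣcᵢEᵢ` is genus-2 of square 1 iff `2db − Σcᵢ² = 1` and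
`−2b + Σcᵢ = 1`; this lemma checks `β₃ = 2S + F − E₁ − E₂ − E₃` (k = 3), `β₂ = 3S + F − 2E₁ − E₂`
(k = 2), `β₁ = 5S + F − 3E₁` (k = 1), together with `β·E ≠ 0` for the exceptional classes
`E ∈ {Eᵢ, F − Eᵢ}` (the only ones: a `(−1)`-sphere projects to `T²` with degree 0). `β₃` is
represented by an embedded symplectic genus-2 surface `B` (smooth the two nodes of
`(T² × t₁) ∪ (T² × t₂) ∪ (p × S²)` — genus `1 + 1 + 0 + 2 − 2 = 2`, square 4 — and blow up three of
its points; `β₂, β₁`: `Gr ≠ 0` because the Li–Liu wall-crossing number `±(L·F)/2` of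
`L = −K + 2β` is `±4`, `±6` while the psc chamber of the blown-up ruled surface is empty, and for
generic `J` no negative-square component other than a `(−1)`-sphere can split off — standard, not
re-derived line by line), and `PD(β)` lies in the RELATIVE symplectic cone
`𝒞_M^B = {e ∈ 𝒫 : e·E ≠ 0 ∀ E ∈ ℰ, e·[B] > 0}` of Dorfmeister–Li (JSG 8 (2010) 1–35, Thm 2.7,
arXiv:0805.2957 READ p. 6) — here even `e·E > 0` on every `ω`-exceptional class `Eᵢ, F − Eᵢ` of the
product-type form — so there is a symplectic form with `[ω] = PD[B]` for which `B` is symplectic.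
Then `W = X_k ∖ ν(B)` is an EXACT (`[ω]|_W = 0`) strong filling of the same contact manifold
`(Y_{2,−1}, ξ_BW)` (concave divisor neighbourhood of a square-1 genus-2 curve, as in both cards) with
`b₁(W) = b₁(X_k) = 2` (Mayer–Vietoris as in `complement_bookkeeping`, `r = 2`), `χ(W) = χ(X_k) + 2 =
k + 2`, `b⁺ = 0`, `b⁻(W) = k + 1` (`β^⊥` negative definite). The family is FINITE: the constraints
`Σcᵢ = 2b + 1`, `Σcᵢ² = 2db − 1`, `1 ≤ cᵢ ≤ d` have, for `b = 1`, exactly the three solutions above, and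
a complete search over `b ≤ 8` (folder script `genus2_classes.py`; `d ≤ 2b + 3` is forced) finds for
`b ≥ 2` only
solutions with some `cᵢ = d`, i.e. `β·(F − Eᵢ) = 0`: then the symplectic sphere `F − Eᵢ` lies in the
complement, which is therefore NOT exact (cone boundary). The same boundary phenomenon kills the
cards' `b₁ = 4` ruled-over-`Σ₂` models for every `k ≥ 1` (a section has `C·Eᵢ + C·(F − Eᵢ) = C·F = 1`;
TRIAGE-r1-2 found this independently) and pushes the rational `b₁ = 0` models up to `χ = 17`. So the
KNOWN exact-filling geography of `(Y_{2,−1}, ξ_BW)` is: `(b₁; χ, b⁻) = (4; −2, 1)` (`D₋₁(Σ₂)` with the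
exact form `[ω] = PD[S₊]`), `(2; 3, 2), (2; 4, 3), (2; 5, 4)` (THIS lemma: `β₁, β₂, β₃`), `(0; ≥ 17, …)`
(rational), `(0; 37, 28)` (Milnor fibre of `z² = x⁵ + y¹⁰` = Horikawa complement: `μ = 36`,
`(b⁺, b⁻, b⁰) = (4, 28, 4)`, `2p_g = μ₀ + μ₊ = 8` — cycle 3 erratum, gen 2 wrote `32 = b⁺ + b⁻`); the door is
`(2; 1, 0)`, on the line `b⁻ = χ − 1` forced by `b⁺(W) = b₃(W) = 0`, two `χ`-steps below `W(β₁)` —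
the closest known object to a door complement. In particular the dichotomy "exact ⇒ `b₁(W) ∈ {0, 4}`"
proposed as the sharpened K1 in TRIAGE-r1-3 (and implicit in r1-2's "only known exact fillings") is
FALSE as a statement about all exact fillings: `W(β₁), W(β₂), W(β₃)` are exact with `b₁ = 2`; only its
restriction to `χ(W) ≤ 2` is open. The gap `χ(W) = 2, b₁ = 2` would need a genus-2
square-1 class with `K·β = 1` in a closed symplectic `(2, 2)`-manifold: none in `T² × S²` (`2db = 1`),
`S² ×~ T²` (`d = 2b + 1 ⇒ β² = −(2b + 1)`), or any κ ∈ {0, 1} one (`K` torsion, or `K = (2g − 2)T`,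
`2 ∤ 1`). Card K1 in TRIAGE-r1-2's form "χ(W) ≤ 1 ⇒ W ≅ D₋₁(Σ₂)" survives and could be pushed to
`χ(W) ≤ 2`; the `b₁ ∈ {0, 2g}` dichotomy and the "unique b₁ = 2 filling type" rhetoric do not.
(For the cup-product strengthening C⁺⁺ see also the κ = 0 witness `Nil⁴/Γ` of TRIAGE-r1-1/2 (N1):
filiform nilmanifold, `e¹ ∧ e² = −de³` exact; Baldridge's `X_g` above are the κ = 1 witnesses and his
`g = 1` case is of that nilmanifold type.)
ALSO (card semidefinite-filling-door, lever (b)): `W₃` satisfies every topological hypothesis of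
Chen, arXiv:2404.01105 Thm 1 (READ p. 2) — T.1 the boundary fibre (meridian of `B`) bounds the disc
`E₁ ∖ ν(B)` in `W₃`; T.2 `ω|_{W₃}` is exact and `c₁` vanishes on spherical classes (a sphere in `W₃`
has `A·F = 0` since it projects null-homotopically to `T²`, and `K·A = (F − β₃)·A = 0` because
`K + β₃ = F`); T.3 `Q ≤ 0` (`b⁺ = 0`) — yet `W₃` is not the disc bundle (`b₁ = 2 ≠ 4`), so by that
theorem its first (Siegel / Gutt–Hutchings) capacity is INFINITE: the "finite capacity" escape
clause the card hopes to close is inhabited by an honest exact filling two `χ`-steps above the door,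
so infinite capacity alone cannot corner the door either. [cite: arXiv:0805.2957 Thm 2.7;
arXiv:2404.01105 Thm 1] -/
theorem ruledT2_genus_two_classes :
    (2 * 2 * 1 - (1 + 1 + 1) = (1 : ℤ) ∧ -2 * 1 + (1 + 1 + 1) = (1 : ℤ) ∧ (2 : ℤ) - 1 ≠ 0) ∧
    (2 * 3 * 1 - (4 + 1) = (1 : ℤ) ∧ -2 * 1 + (2 + 1) = (1 : ℤ) ∧ (3 : ℤ) - 2 ≠ 0 ∧ (3 : ℤ) - 1 ≠ 0) ∧
    (2 * 5 * 1 - 9 = (1 : ℤ) ∧ -2 * 1 + 3 = (1 : ℤ) ∧ (5 : ℤ) - 3 ≠ 0) := by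
  norm_num

/-- … and the complements' numerics: `χ(W_k) = χ(X_k) − χ(Σ₂) = k + 2`, `b⁻(W_k) = k + 1`, `b₁ = 2`;
the door's `(χ, b⁻) = (1, 0)` is exactly `k = −1`. In `S² ×~ T²` (`S₋² = −1`, `F² = 0`, `S₋·F = 1`,
`K = −2S₋ − F`) a genus-2 class `dS₋ + bF` of square 1 needs `d = 2b + 1` and then has square
`−(2b + 1) ≠ 1`: no `k = 0` member. [folklore] -/
theorem ruledT2_filling_numerics (k b : ℤ) :
    ((2 - 2 * 2 + (2 + k)) - (2 - 2 * 2) = k + 2) ∧ ((k + 2 = 1 ∧ k + 1 = 0) ↔ k = -1) ∧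
      (-(2 * b + 1) ^ 2 + 2 * (2 * b + 1) * b = -(2 * b + 1)) := by
  refine ⟨by omega, by omega, by ring⟩

end IdeaLevel

/-! ## §11 Targets — the stubs of the three registered skeletons (cycle 3, gen 3)

Skeletons registered 2026-08-16 04:21–04:45 (no `PICKED.md`, payload `targets = []`):
`Lines/canonical-cap-filling.lean` (S1 `stub_taubesCanonicalCurve`, S2 `stub_rankOneFlatComplement`,
S3 `stub_liouvillePackaging`, S4 `stub_flatFillingExclusion`, S5 `stub_closingUp`),
`Lines/weinstein_door_presentation.lean` (W1 `stub_donaldsonGirouxDecomposition`,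
W2 `stub_complementBetti`, W3 `stub_cappingAdjunction`, W4 `stub_steinExclusion`),
`Lines/liouville_genus_two_complement.lean` (L1 `stub_canonicalCurve`, L2 `stub_exactComplement`,
L3 `stub_complementTopology`, L4 `stub_smallFillingRigidity`). AUDIT RESULT: **no stub is cheaply
false, and no stub is junk-false** — details:

DOOR-VACUITY MAP (which stubs can be false at all while the crux is true). S1, L1, L2, L3 carry the
door hypotheses `(rank H₁, rank H₂)(N) = (2, 1)` on a closed symplectic `N`; S5 and W3 carry
hypotheses that FORCE a door (S5: `IsFlat` ⇒ `b₂(N) = 1` ⇒ door numerics, `closingUp_without_meridian`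
below; W3: capping a `b₁ = 2`, `Q ≡ 0` Boothby–Wang Stein filling gives a closed symplectic
`(2, 1)`-manifold); W2's `P` is a closed `(2, 1)`-manifold glued from a Stein piece. All of these are
VACUOUSLY TRUE if NoGenusTwoDoor holds: they cannot be killed without killing the crux, and a kill of
the crux kills the lines anyway. S4, W4, L4 are crux-EQUIVALENT (kernel-checked converses in the
files). The only stubs with NON-door instances are S2 (`rank H₂(N) = 1`: `ℂP² ⊃` line / conic /
symplectic cubic, fake planes), S3 (any closed symplectic `N`, any symplectic `B` with exact
complement) and W1 (`rank H₂(N) = 1`) — checked on paper: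
* S2 (i) `[s] ∈ ker(H²(N) → H²(N ∖ B)) = ℝ·PD[B]` because `H²(N, N ∖ B; ℝ) ≅ H⁰(B)` (Thom) and
  `[B] ≠ 0` (positive `s`-area), so `s|_{N∖B}` is exact (de Rham on the open manifold); (ii)
  `im(H₂(N ∖ B) → H₂(N)) = ker(· B)` is torsion iff `b₂(N) ≤ 1` — flatness holds at `b₂ = 1` for ANY
  closed surface `B`, symplectic or not (`ℂP² ∖ conic ≃ ℝP²`, `ℂP² ∖ cubic`: tube tori, all
  null in `H₂(ℂP²)`). TRUE.
* S3: exactness forces `[s] = λ·PD[B]`, `λ > 0`, `B·B > 0`; in the symplectic normal form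
  `s = d((ρ + c)α)` on `ν ∖ B` the constant `c` equals the wrapping number `/2π`, which is
  `−λ' < 0` for EVERY primitive (the meridian is rationally null-homologous in `N ∖ B` since
  `·B : H₂(N) → ℤ` is non-zero), so the Liouville field `(ρ + c)∂_ρ` EXITS `N ∖ ν_ε(B)` for small
  `ε`; a defect `π^*β₀ + df` of the given primitive changes the field by a HORIZONTAL vector plus
  `X_f`, and `f` is cut off away from `∂W` — the packaging exists for every `V ⊇ B` (thin tube, `B`
  compact). TRUE (McLean 2012 §5 / Diogo–Lisi L. 1.2 as cited by the lines; `(ℂP², conic)` ↦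
  `D*ℝP²`, `(S² × S², Δ)` ↦ `D*S²` sanity cases).
* W1: Donaldson 1996 Thm 1 + Giroux 2017 Thm 3/Prop 6/Cor 19: THEOREM in print; typing risks only
  (`SteinStructure.boundary_eq` wants `∂W = {φ = max φ}` — Giroux's `φ ≤ 0 = φ|_{∂F}` fits).
JUNK AUDIT of the typed vocabulary (read in `Literature/…`): `BoundaryData.range_incl = I.boundary M`
(honest boundary); `IsClosedGluing` = two smooth embeddings covering `P`, meeting exactly on the
relation (so the bare `Equiv φ` of W1/W2 is automatically a homeomorphism); `SteinStructure`: for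
non-empty compact `W` the clause `IsBoundaryPoint x ↔ φ x = sSup (range φ)` forces `∂W ≠ ∅` (φ
attains its max), `convex`/`IsLiouvilleDomain.nondegenerate` are stated through `mextDeriv`, whose
junk value `0` at non-differentiable points (§1) makes them FAIL rather than pass — safe; the EMPTY
`W` is vacuously Stein/Liouville but every stub has `[ConnectedSpace W]` or `Vᶜ ⊆ range ι`;
`IsBoothbyWang ξ g n` pins `(g, n) = (b₁(M)/2, |Tors H₁(M)|)` topologically (no multiplicity that
would make W3's conclusion contradictory), and a clause `e^*λ₀ = f·λ`, `f ≠ 0`, forces `e` to be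
orientation-compatible (`e^*(λ₀ ∧ dλ₀) = f² λ ∧ dλ`), so "contactomorphic to the link" in L2/L4 is
the ORIENTED statement; `IsSymplecticSurface` (non-degenerate `b^*s`) forces `S` orientable, so
`rank H₁(S) = 4` means genus 2 (the non-orientable `#⁵ℝP²` also has rank 4 but is excluded);
`IsFlat`/`MeridianInjective`/`BoundarySpansH2` are over the tree's homology functor (honest). The
LINK MODEL of L2/L4 was re-verified: the weight-`(5, 2, 1)` circle action on
`{x² + y⁵ + z¹⁰ = 0} ∩ S⁵` is FREE (`z ≠ 0 ⇒ t = 1`; `z = 0` forces `x, y ≠ 0` and `t² = t⁵ = 1`),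
the quotient curve misses `[1:0:0]`, `[0:1:0]`, has `2g − 2 = 10·(10 − 8)/10 = 2`, Euler number
`−10/10 = −1`: `(Y_{2,−1}, ξ_BW)` ✓; Milnor fibre `μ = 36`, `p_g = #{2j + k ≤ 5} = 4`,
`(b⁺, b⁻, b⁰) = (4, 28, 4)` (§10 erratum).
LOAD-BEARING (§5) honoured by all three files (every `N`-stub keeps `[CompactSpace N]`, closedness
and non-degeneracy; each file instantiates `Negative…false_without_compact` in an `example`).
INFORMATION FOR THE LEADS: (a) S5 does not need `MeridianInjective` (`closingUp_without_meridian`: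
the ghost root `[B] = 2h`, `K = −h` ALSO has `K² = 1`, hence `χ = −1`, `b₁ = 2`); (b) W2 needs
Mayer–Vietoris for the CLOSED cover `jW(W) ∪ jD(D)` — collars (`BoundaryData.nonempty_collar`, a
named fact) or an open thickening are the formal cost, not the algebra; (c) L3 is door-vacuous but
its honest proof is the §9 bookkeeping; (d) the three HARDEST stubs S4/W4/L4 are the crux in filling
language — this file has nothing that bites them beyond §10 (the `W_k` family: flatness/`Q ≡ 0` is
the load-bearing hypothesis, `b₁ = 2` alone is refuted). No `stub_false` proposal is warranted. -/
section Targets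

/-- S5 WITHOUT MERIDIAN INJECTIVITY (information for the `canonical-cap-filling` lead). In the
rank-one odd lattice a genus-2 symplectic class `[B] = m h` with `K ≡ k h` satisfies
`2 = 2g − 2 = B² + K·B = m² + k m`; the integer solutions are `(m, k) ∈ {(1, 1), (2, −1), (−1, −1),
(−2, 1)}`, so `K² = k² = 1` in EVERY branch, whence `2χ + 3σ = 1`, `χ = −1`, `b₁ = 2`
(`closingUp_arith` of the skeleton assumed `m = 1`). So `ClosingUp` holds with `MeridianInjective`
deleted; Liu's theorem is needed only to say the `m = 2` branch is EMPTY, not to get `(2, 1)`. [folklore] -/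
theorem closingUp_without_meridian {m k : ℤ} (hadj : 2 = m * m + k * m) : k * k = 1 := by
  have h2 : 2 = m * (m + k) := by linear_combination hadj
  have hm : m ∣ 2 := ⟨m + k, h2⟩
  have hmle : m ≤ 2 := Int.le_of_dvd (by norm_num) hm
  have hmge : -2 ≤ m := by
    have := Int.le_of_dvd (by norm_num) (Int.neg_dvd.2 hm)
    linarith
  interval_cases m
  · have hk : k = 1 := by omega
    subst hk; norm_num
  · have hk : k = -1 := by omega
    subst hk; norm_num
  · omega
  · have hk : k = 1 := by omega
    subst hk; norm_num
  · have hk : k = -1 := by omega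
    subst hk; norm_num

/-- … hence the closing-up conclusion `b₁ = 2` without `m = 1`: `k² = 2χ + 3σ = 2(3 − 2b₁) + 3`. [folklore] -/
theorem closingUp_arith_general {m k b₁ : ℤ} (hadj : 2 * 2 - 2 = m * m + k * m)
    (hk : k * k = 2 * (2 - 2 * b₁ + 1) + 3 * 1) : b₁ = 2 := by
  have h1 : k * k = 1 := closingUp_without_meridian (m := m) (k := k) (by linarith)
  rw [h1] at hk
  omega

/-- W3's square clause is pure topology (information for the `weinstein-door-presentation` lead):
capping gives `b₂(X) = 1`, `H₂(X)/Tors = ℤh` unimodular with `h² = +1` (`[Σ]² = n > 0`), `[Σ] = a h`,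
so `n = a²`; only the genus clause `2g − 2 = a² + a` (sign of `K·h`) needs Liu. Here: a unimodular
rank-one form `⟨u⟩`, `u ∈ {1, −1}`, representing a positive number `n = a² u` has `u = 1`. [folklore] -/
theorem cappingAdjunction_square {u a n : ℤ} (hu : u = 1 ∨ u = -1) (hn : n = a * a * u)
    (hpos : 0 < n) : u = 1 ∧ n = a * a := by
  rcases hu with rfl | rfl
  · exact ⟨rfl, by linarith⟩
  · exfalso; nlinarith [sq_nonneg a]

end Targets

/-! ## §12 A computable kill criterion: door pencils as positive factorizations (cycle 3) -/

section PencilFactorization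

/-- THE MAPPING-CLASS-GROUP FORM OF A KILL (for a future compute seat; complements §8). A genus-`g`
Lefschetz fibration `X → S²` with `n` singular fibres, `b₁(X) = 2` and `d` pairwise disjoint
`(−1)`-SECTIONS has `χ(X) = 4 − 4g + n`, `b₂(X) = χ(X) − 2 + 2b₁ = χ(X) + 2`, and blowing the
sections down leaves a closed SYMPLECTIC manifold (Gompf–Thurston) with `b₁ = 2`,
`b₂ = χ(X) + 2 − d`. For the door-pencil numerics of §8 (`2g = a² + a + 2`, `n = 3a² + 2a − 1`,
`d = a²`) this is `b₂ = 1`: **any positive factorization of the boundary multitwist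
`t_{δ₁}⋯t_{δ_{a²}} = t_{c₁}⋯t_{c_n}` in `Mod(Σ_g^{a²})` whose vanishing cycles span a subspace of
`H₁(Σ_g; ℚ)` of codimension exactly `2` IS A DOOR** (`σ = 1 − a²` is then automatic), and conversely
a door yields such factorizations for all `a ≫ 0` (Donaldson pencils; `a = 1` is dead by
Matsumoto–Endo, `pencil_a_one_dead`). Smallest live case `a = 2`: `(g, boundary components, n) =
(4, 4, 15)`, vanishing cycles spanning a 6-dimensional subspace of `H₁(Σ₄; ℚ) = ℚ⁸`; next `a = 3`:
`(7, 9, 32)`, span of dimension 12 in `ℚ¹⁴`. No such factorization is known; the known small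
genus-4 positive factorizations with `b₁ > 0` (generalised Matsumoto relations on `Σ₂ × S² # 4\overline{ℂP²}`,
`b₁ = 4`; fibre sums, `n ≥ 30`) miss `(n, b₁) = (15, 2)`. Not searched by computer this cycle
(random search in `Mod(Σ₄⁴)` is hopeless; a structured search would start from lifts of the
genus-2 chain/Matsumoto relations under the bisection covering `Σ₄ → Σ₂`). [folklore] -/
theorem pencil_factorization_door {a g n χ b2 : ℤ} (hg : 2 * g = a ^ 2 + a + 2)
    (hn : n = 3 * a ^ 2 + 2 * a - 1) (hχ : χ = 4 - 4 * g + n) (hb2 : b2 = χ - 2 + 2 * 2) :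
    b2 - a ^ 2 = 1 ∧ χ = a ^ 2 - 1 := by
  constructor
  · linear_combination hb2 + hχ + hn - 2 * hg
  · linear_combination hχ + hn - 2 * hg

/-- The two smallest live cases, as numerals: `a = 2 ↦ (g, d, n, dim span) = (4, 4, 15, 6)`,
`a = 3 ↦ (7, 9, 32, 12)`. [folklore] -/
theorem pencil_factorization_small_cases :
    (2 * 4 = 2 ^ 2 + 2 + 2 ∧ 3 * 2 ^ 2 + 2 * 2 - 1 = 15 ∧ 2 * 4 - 2 = 6) ∧
    (2 * 7 = 3 ^ 2 + 3 + 2 ∧ 3 * 3 ^ 2 + 2 * 3 - 1 = 32 ∧ 2 * 7 - 2 = 12) := by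
  norm_num

end PencilFactorization

end Summit.SmoothPoincare4.SmoothPoincare4.Cruxes.NoGenusTwoDoor.Disproof
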